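import Summits.BirchSwinnertonDyer.BirchSwinnertonDyer.Theorems.UniversalToricDescentSignedSettingNoPTorsion
import Literature.NumberTheory.EllipticCurves.IwasawaSelmerControlKernelCardProofs
import Literature.NumberTheory.EllipticCurves.IwasawaSelmerControlCokerProofs
import Literature.NumberTheory.EllipticCurves.IwasawaSelmerProofs
import Literature.NumberTheory.EllipticCurves.Kobayashi2003.SignedSelmerRankBoundProofs
import HarnessLib

/-!
# Route `UniversalToricDescent`, crux #3 C₀ `TwinSplitIMCAtThreeGoodSSApZero` (stmt-BirchSwinnertonDyer-23594),
# `⊇`-port banking: the GLOBAL half of the signed control theorem at the bottom layer in the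
# `Setting` — `h_n : H¹(K_n, E[p^∞]) → H¹(K_∞, E[p^∞])` injective for every `n` (Kobayashi 2003
# Lemma 9.1 = Hatley–Lei–Vigni 2022 Prop. 3.9, injectivity), `h₀` maps `Sel_{p^∞}(E/K)` INTO
# `Sel^ε(E/K_∞)^Γ` (Lemma 3.7 + the easy inclusion), and `h₀` is ONTO the `Γ`-invariants of
# `H¹(K_∞, E[p^∞])` (Greenberg Lemma 3.2)

Width seat bsd-wall-utd-p2-w2 (prover, `--supports stmt-BirchSwinnertonDyer-23594`; line
`threeframes-apzero`, banking for the `⊇`-port per the pen's act D, 2026-08-28). Sequel of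
`UniversalToricDescentSignedSettingNoPTorsion` (p606514: `E(K_∞)[p^∞] = 0` and `E(K_{∞,w})[p] = 0`
in the `Setting` of `Literature/…/AnticyclotomicSignedSelmer.lean`). The third named fact of that
carrier file, `AcSigned.hatleyLeiVigni2022_prop39_control_base` (signed control between `K` and
`K_∞`), has a GLOBAL half (inflation–restriction) and a LOCAL half (local conditions). This file
proves the global half and the easy direction of the local half, on the fact's own objects:

* §1 `noPTorsion_base_of_setting`: `E(K)[p] = 0`; `localPointsInfty_noPPowTorsion_of_setting`:
  `E(K_{∞,w})[p^∞] = 0` at every `v ∣ p` (the input "`A^{G_{F_{∞,v}}} = 0`" of every local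
  inflation–restriction step, B.-D. Kim 2013 Prop. 3.2 / Hatley–Lei–Vigni Lemma 3.8).
* §2 `layerToInfty_injective_of_setting`: **`h_n : H¹(K_n, E[p^∞]) → H¹(K_∞, E[p^∞])` is injective
  for EVERY layer `n`** (`ker h_n ≅ H¹(Γ_n, E(K_∞)[p^∞]) = 0`; tree
  `natCard_ker_layerToInfty_eq_natCard_fixedPoints`, `natCard_fixedBy_layerSubgroup_eq_one`) — in
  particular the FIRST CONJUNCT of `hatleyLeiVigni2022_prop39_control_base` verbatim
  (`hatleyLeiVigni2022_prop39_injective_of_setting`), with no `(Heeg)`/`(Tam)` hypothesis.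
* §3 `layerToInfty_mem_signedSelmerInfty_and_conjH1_eq` (no `Setting` needed): for
  `c ∈ Sel_{p^∞}(E/K) = Sel^ε(E/K_0)` (`Kobayashi2003.signedSelmerLayer_zero_eq`, Hatley–Lei–Vigni
  Lemma 3.7), `h₀ c ∈ Sel^ε(E/K_∞)` and `conj_σ (h₀ c) = h₀ c` for all `σ ∈ Γ_K` — the `→` direction
  of the fact's second conjunct.
* §4 `exists_layerToInfty_zero_eq_of_conjH1_eq` (no `Setting` needed): every `γ`-fixed class of
  `H¹(K_∞, E[p^∞])` is `h₀ y` for some `y ∈ H¹(K, E[p^∞])` (`coker h₀ = 0`, `cd_p ℤ_p = 1`; tree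
  `ZpExtension.mem_range_resOfLe_of_conjH1_eq`).

WHAT REMAINS of `hatleyLeiVigni2022_prop39_control_base` after this file (said plainly): the LOCAL
statement «for `y ∈ H¹(K, E[p^∞])` with `h₀ y ∈ Sel^ε(E/K_∞)`, `y ∈ Sel_{p^∞}(E/K)`», i.e. the
signed local control at `v ∣ p` (`(ℋ^ε_w)^Γ` pulls back to `E(K_v) ⊗ ℚ_p/ℤ_p`: Kobayashi 2003
Thm. 9.3 / Iovita–Pollack 2006 Thm. 6.8, formal-group input) and Greenberg's Lemma 3.3 with `(Tam)`
at `v ∤ p` — NOT in this file, not in the tree. HONEST STATUS: helper theorems; no stub of the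
crux is proved; no definition, no named fact, no `sorry`. BSD is not proved by any of this.

References: [Kobayashi2003] S. Kobayashi, Invent. Math. 152 (2003), Lemma 9.1 (p. 25), Thm. 9.3;
[HatleyLeiVigni2022] J. Hatley, A. Lei, S. Vigni, Manuscripta Math. 167 (2022), Lemma 3.7, Lemma
3.8, Prop. 3.9; [GreenbergLNM1716] R. Greenberg, LNM 1716 (1999), §3 Lemmas 3.1–3.2 (p. 86), §4
Lemma 4.3 (p. 103); [BDKim2013] B. D. Kim, J. Aust. Math. Soc. 95 (2013), Prop. 3.2;
[IovitaPollack2006] Lemma 2.1, Thm. 6.8.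
-/

set_option autoImplicit false
-- `…BirchSwinnertonDyer.BirchSwinnertonDyer.Theorems…` is the problem's mandated namespace (D-0017).
set_option linter.dupNamespace false

noncomputable section

open scoped Classical

namespace Summit.BirchSwinnertonDyer.BirchSwinnertonDyer.Theorems.UniversalToricDescentSignedSetting

open NumberField IsDedekindDomain Field WeierstrassCurve
open Literature.NumberTheory.EllipticCurves Literature.NumberTheory.EllipticCurves.Rank1Residual
  Literature.NumberTheory.EllipticCurves.GreenbergSelmer Literature.NumberTheory.EllipticCurves.AcSigned
  Literature.NumberTheory.EllipticCurves.Kobayashi2003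
  Summit.BirchSwinnertonDyer.BirchSwinnertonDyer.Theorems.UniversalToricDescentTowerTorsion

variable (W : WeierstrassCurve ℚ) [W.IsGloballyMinimal] (K : Type) [Field K] [NumberField K]
  (p : ℕ) [Fact p.Prime] (κ : ZpExtension K p) (𝔭 𝔭' : HeightOneSpectrum (𝓞 K))

/-! ### §1 `E(K)[p] = 0` and `E(K_{∞,w})[p^∞] = 0` in the `Setting` -/

/-- **In the `Setting`, `E(K)[p] = 0`**: a `K`-rational point `P` with `p • P = O` gives the
`Γ_K`-fixed (hence `ker κ`-fixed) point `P ∈ E(K̄)` of order dividing `p`, which vanishes by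
`iovitaPollack2006_lemma21_noPTorsion_top_holds`; `E(K) ↪ E(K̄)`.
[cite: IovitaPollack2006, Lemma 2.1 (arXiv:math/0411496 p. 5)] -/
theorem noPTorsion_base_of_setting (hS : Setting W K p κ 𝔭 𝔭') :
    ∀ P : (W.baseChange K).toAffine.Point, p • P = 0 → P = 0 := by
  intro P hP
  have h := iovitaPollack2006_lemma21_noPTorsion_top_holds W K p κ 𝔭 𝔭' hS
    (WeierstrassCurve.toGeomPoints (W.baseChange K) P)
    (fun τ _ ↦ WeierstrassCurve.smul_toGeomPoints (W.baseChange K) τ P)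
    (by rw [← map_nsmul, hP, map_zero])
  exact WeierstrassCurve.toGeomPoints_injective (W.baseChange K) (by rw [h, map_zero])

/-- **In the `Setting`, `E(K_{∞,w})[p^∞] = 0` at every `v ∣ p`** (`w` the place of `K_∞` singled out
by `closureEmb`): a point of the local tower killed by `p^k` is `O` (induction on `k` from
`bdKim2013_prop32_localPoints_noPTorsion_holds`, the tower points being a subgroup). This is the
input "`A^{G_{F_{∞,v}}} = 0`" of the local inflation–restriction steps (B.-D. Kim 2013 Prop. 3.2:
"which implies that `A^{G_{F_{∞,v}}} = 0`"; Hatley–Lei–Vigni Lemma 3.8).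
[cite: BDKim2013, Prop. 3.2 (p. 193)] [cite: HatleyLeiVigni2022, Lemma 3.8] -/
theorem localPointsInfty_noPPowTorsion_of_setting (hS : Setting W K p κ 𝔭 𝔭')
    {v : HeightOneSpectrum (𝓞 K)} (hv : ((p : ℕ) : 𝓞 K) ∈ v.asIdeal) (k : ℕ) :
    ∀ P : localPoints (W.baseChange K) (v.adicCompletion K),
      P ∈ localPointsInfty κ (closureEmb (K := K) (v.adicCompletion K)) (W.baseChange K) →
        p ^ k • P = 0 → P = 0 := by
  induction k with
  | zero =>
    intro P _ hP
    rwa [pow_zero, one_smul] at hP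
  | succ k ih =>
    intro P hPmem hP
    have h1 : p ^ k • P ∈
        localPointsInfty κ (closureEmb (K := K) (v.adicCompletion K)) (W.baseChange K) :=
      AddSubgroup.nsmul_mem _ hPmem _
    have h2 : p • (p ^ k • P) = 0 := by rw [← mul_smul, ← pow_succ', hP]
    have h3 : p ^ k • P = 0 :=
      bdKim2013_prop32_localPoints_noPTorsion_holds W K p κ 𝔭 𝔭' hS v hv _ h1 h2
    exact ih P hPmem h3

/-! ### §2 `h_n : H¹(K_n, E[p^∞]) → H¹(K_∞, E[p^∞])` is injective for every `n` (Kobayashi Lemma 9.1) -/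

/-- **In the `Setting`, every restriction `h_n : H¹(K_n, E[p^∞]) → H¹(K_∞, E[p^∞])` is injective**
(`n ≥ 0`; `K_0 = K`): by inflation–restriction `#ker h_n = #E[p^∞]^{Gal(K̄/K_n)}`
(`natCard_ker_layerToInfty_eq_natCard_fixedPoints`, its finiteness instance from `E(K)[p] = 0`) and
the latter is `1` because `E(K_∞)[p^∞] = 0` (`natCard_fixedBy_layerSubgroup_eq_one`). Kobayashi's
Lemma 9.1 ("The morphisms `Sel^±(E/K_n) → Sel^±(E/K_∞)` are injective … inflation-restriction … and
`E(K_∞)_{p^∞} = 0`") on ALL of `H¹`, for the anticyclotomic tower of the `Setting`.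
[cite: Kobayashi2003, Lemma 9.1 (p. 25)] [cite: GreenbergLNM1716, §3 Lemma 3.1 (p. 86) and §4 Lemma 4.3 (p. 103)] -/
theorem layerToInfty_injective_of_setting (hS : Setting W K p κ 𝔭 𝔭') (n : ℕ) :
    Function.Injective ((W.baseChange K).layerToInfty κ n) := by
  haveI := hS.isElliptic
  have hK := noPTorsion_base_of_setting W K p κ 𝔭 𝔭' hS
  haveI := (W.baseChange K).finite_fixedPoints_kerSubgroup_geomPrimaryTorsion κ hK
  have h := (W.baseChange K).natCard_ker_layerToInfty_eq_natCard_fixedPoints κ n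
  rw [(W.baseChange K).natCard_fixedBy_layerSubgroup_eq_one κ hK n] at h
  exact (AddMonoidHom.ker_eq_bot_iff _).mp (AddSubgroup.eq_bot_of_card_eq _ h)

/-- **First conjunct of `AcSigned.hatleyLeiVigni2022_prop39_control_base`, PROVED in the `Setting`
(verbatim shape, and WITHOUT the fact's `(Heeg)`/`(Tam)` hypotheses):** `h₀` is injective on
`Sel_{p^∞}(E/K) = selmerLayer κ 0`. [cite: HatleyLeiVigni2022, Prop. 3.9 (injectivity) and Lemma 3.7]
[cite: Kobayashi2003, Lemma 9.1 (p. 25)] -/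
theorem hatleyLeiVigni2022_prop39_injective_of_setting (hS : Setting W K p κ 𝔭 𝔭') :
    ∀ c ∈ (W.baseChange K).selmerLayer κ 0, (W.baseChange K).layerToInfty κ 0 c = 0 → c = 0 :=
  fun c _ hc ↦ layerToInfty_injective_of_setting W K p κ 𝔭 𝔭' hS 0 (by rw [hc, map_zero])

/-! ### §3 `h₀(Sel_{p^∞}(E/K)) ⊆ Sel^ε(E/K_∞)^Γ` (any base, any `ℤ_p`-extension, either sign) -/

section AnyBase

variable {F : Type} [Field F] [NumberField F] (V : WeierstrassCurve F) (κ' : ZpExtension F p)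

omit [NumberField F] in
/-- Every `σ ∈ Γ_F` lies in `κ⁻¹(p⁰ℤ_p) = Gal(F̄/F_0)` (`F_0 = F`). [folklore] -/
theorem mem_layerSubgroup_zero (σ : absoluteGaloisGroup F) : σ ∈ κ'.layerSubgroup 0 :=
  ZpExtension.mem_layerSubgroup.mpr (by rw [pow_zero]; exact one_dvd _)

/-- **`h₀(Sel_{p^∞}(E/F)) ⊆ Sel^ε(E/F_∞)^Γ`** for any elliptic curve over a number field `F`, any
`ℤ_p`-extension `κ'` and either sign `ε`: `Sel_{p^∞}(E/F) = Sel^ε(E/F_0)` (no trace condition at the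
bottom layer, `Kobayashi2003.signedSelmerLayer_zero_eq`; Hatley–Lei–Vigni Lemma 3.7
"`Sel^±_{p^m}(E/K) = Sel_{p^m}(E/K)`"), `h₀(Sel^ε(E/F_0)) ⊆ Sel^ε(E/F_∞) = ⋃ₙ hₙ(Sel^ε(E/F_n))`, and
the image of `h₀` is fixed by every `conj_σ` (`range_layerToInfty_le_layerInvariants`, all of `Γ_F`
being `Gal(F̄/F_0)`). The `→` direction of the second conjunct of
`AcSigned.hatleyLeiVigni2022_prop39_control_base`. [cite: HatleyLeiVigni2022, Lemma 3.7 and Prop. 3.9]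
[cite: Kobayashi2003, Def. 1.1 and Lemma 9.1 (p. 25)] -/
theorem layerToInfty_mem_signedSelmerInfty_and_conjH1_eq (ε : ℤˣ)
    {c : V.subgroupH1 p (κ'.layerSubgroup 0)} (hc : c ∈ V.selmerLayer κ' 0) :
    V.layerToInfty κ' 0 c ∈ signedSelmerInfty V κ' ε ∧
      ∀ σ : absoluteGaloisGroup F, V.conjH1 p κ'.kerSubgroup σ (V.layerToInfty κ' 0 c) =
        V.layerToInfty κ' 0 c := by
  refine ⟨map_layerToInfty_signedSelmerLayer_le V κ' ε 0 ⟨c, ?_, rfl⟩, fun σ ↦ ?_⟩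
  · rw [signedSelmerLayer_zero_eq]
    exact hc
  · have hmem : V.layerToInfty κ' 0 c ∈ V.layerInvariants κ' 0 :=
      V.range_layerToInfty_le_layerInvariants_holds κ' 0 ⟨c, rfl⟩
    exact (V.mem_layerInvariants_iff κ' 0 _).mp hmem σ (mem_layerSubgroup_zero p κ' σ)

/-- The same, in the fact's `↔`-free shape: every element of `h₀(Sel_{p^∞}(E/F))` lies in
`Sel^ε(E/F_∞)` and is fixed by all `conj_σ`. [cite: HatleyLeiVigni2022, Lemma 3.7 and Prop. 3.9] -/
theorem mem_signedSelmerInfty_and_conjH1_eq_of_mem_map_layerToInfty (ε : ℤˣ)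
    {s : V.subgroupH1 p κ'.kerSubgroup}
    (hs : s ∈ (V.selmerLayer κ' 0).map (V.layerToInfty κ' 0)) :
    s ∈ signedSelmerInfty V κ' ε ∧
      ∀ σ : absoluteGaloisGroup F, V.conjH1 p κ'.kerSubgroup σ s = s := by
  obtain ⟨c, hc, rfl⟩ := AddSubgroup.mem_map.mp hs
  exact layerToInfty_mem_signedSelmerInfty_and_conjH1_eq p V κ' ε hc

/-! ### §4 `coker h₀ = 0`: every `γ`-fixed class of `H¹(F_∞, E[p^∞])` comes from `H¹(F, E[p^∞])` -/

/-- **Greenberg's Lemma 3.2 at the bottom layer** (any elliptic `E/F`, any `ℤ_p`-extension, `γ` a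
topological generator): a class `s ∈ H¹(F_∞, E[p^∞])` with `conj_γ s = s` is `h₀ y` for some
`y ∈ H¹(F, E[p^∞])` (`coker h₀ ↪ H²(Γ, E(F_∞)[p^∞]) = 0` since `cd_p ℤ_p = 1`; tree
`ZpExtension.mem_range_resOfLe_of_conjH1_eq`). So, given §2–§3, the fact
`hatleyLeiVigni2022_prop39_control_base` is reduced to its LOCAL content (module docstring).
[cite: GreenbergLNM1716, §3 Lemma 3.2 (p. 86)] -/
theorem exists_layerToInfty_zero_eq_of_conjH1_eq {γ : absoluteGaloisGroup F}
    (hγ : κ'.IsTopGenerator γ) (s : V.subgroupH1 p κ'.kerSubgroup)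
    (hs : V.conjH1 p κ'.kerSubgroup γ s = s) :
    ∃ y : V.subgroupH1 p (κ'.layerSubgroup 0), V.layerToInfty κ' 0 y = s := by
  have hprim : ∀ m : geomPrimaryTorsion V p, ∃ k : ℕ, p ^ k • m = 0 := fun m ↦ by
    obtain ⟨k, hk⟩ := m.2
    exact ⟨k, Subtype.ext (by rw [AddSubgroupClass.coe_nsmul, hk, ZeroMemClass.coe_zero])⟩
  have hfix : V.conjH1 p κ'.kerSubgroup (γ ^ p ^ 0) s = s := by rwa [pow_zero, pow_one]
  obtain ⟨y, hy⟩ := ZpExtension.mem_range_resOfLe_of_conjH1_eq κ' hγ 0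
    (V.continuous_smul_geomPrimaryTorsion p) hprim s hfix
  exact ⟨y, hy⟩

end AnyBase

end Summit.BirchSwinnertonDyer.BirchSwinnertonDyer.Theorems.UniversalToricDescentSignedSetting

end
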